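import Summits.QuantumFields.YangMills.Theorems.CovarianceBound.Negative.FalseWithoutMinimalitySetup
import Summits.QuantumFields.YangMills.Theorems.CovarianceBound.Negative.SU2Angle

/-!
# `CovarianceBound` — negative-side support: the spread toron is an ABSOLUTE Coulomb minimiser

Support file for crux `stmt-QuantumFields-8780` (`ConvexGribovBody.CovarianceBound`), extracted from the
standing disprover's work file `Cruxes/CovarianceBound/Disproof.lean` (§C). Tree objects only; nothing is
posited; axioms `propext`, `Classical.choice`, `Quot.sound`.

A CERTIFIED point of the fundamental modular region, for `G = SU(2)` in the fundamental representation: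

* `coul` — the crux's slice Coulomb functional (`let coul`, verbatim);
* `omegaL S = diag(e^{iπ/L}, e^{−iπ/L})` (`L = 2S+1`), `toron S` — every direction-`1` link equal to `ω`, all
  other links `1` (flat, holonomy `ω^L = −1` around every `1`-cycle, `omegaL_pow_val`);
* `coul_toron_one_le` — **for `S ≥ 2`, `h = 1` minimises `coul(toron S, ·)` globally**: directions 2, 3 are
  optimal term by term (`Re tr ≤ 2`); along each `1`-line the transformed links `h(y) ω h(y+ê₁)⁻¹`
  multiply (ordered) to a conjugate of `ω^L = −1` (`oprod_lineChain_full`), so their rotation angles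
  sum to `≥ π` (`SU2Angle.pi_le_sum_ang`) and `Σ Re tr = 2 Σ cos θ_i ≤ 2L cos(π/L)` (`sum_cos_le`), the
  value at `h = 1` (`sum_line_le`); the slice bookkeeping is `sum_sliceEdges` / `sum_slice_lines`.

This is the first exactly gauge-fixed non-trivial configuration family available to the line: on it the
crux's integrand and every stub of `Lines/Sketch.lean` can be evaluated in closed form (`ToronTight.lean`).
Generalisation (same certificate, not formalised here): `h = 1` stays an absolute minimiser for every
TRANSVERSELY DRESSED toron `U(y,1) = g(y₂,y₃) ω g(y₂,y₃)⁻¹`, `U(y,2) = U(y,3) = 1` (`g` arbitrary): the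
argument is line-local in direction 1 (each line's ordered product is conjugate to `ω^L = −1`, and
`Re tr(gωg⁻¹) = 2cos(π/L)`) and term-wise in directions 2, 3. The gauge-fixed field is then
`A₁(y) = i sin(π/L) n̂(y₂,y₃)·σ⃗` with an ARBITRARY unit-vector field `n̂` on the transverse torus, so every
transverse Fourier mode `p = (0, p₂, p₃)` of the crux's integrand can be dialled on the fundamental modular
region: `cov(U, 1, p) = 2 L⁻¹ sin²(π/L) |Σ_{y⊥} e^{−2πi p·y⊥/L} n̂(y⊥)|² ≤ 2 L³ sin²(π/L) ≈ 2π² L` — of order `L`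
at EVERY momentum, never more (consistent with the line's `stub_support`, which it meets with `C ≥ 1/2`).
-/

set_option autoImplicit false

namespace Summit.QuantumFields.YangMills.Theorems.CovarianceBound.Negative

open scoped Matrix ComplexConjugate Real
open Literature.MathematicalPhysics.QuantumFieldTheory Literature.MathematicalPhysics.QuantumLattice

noncomputable section

/-! ### The spread toron and its minimality -/

variable {S : ℕ}

/-- The crux's slice Coulomb functional `coul(U,h) = −Σ_{e spatial, t=0} Re tr ρ((U^h)_e)` (its `let coul`,
verbatim). -/
def coul {G : Type} [Group G] [TopologicalSpace G] (r : LatticeRep G) (S : ℕ)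
    (U : GaugeConfig 4 (2 * S + 1) G) (h : Site 4 (2 * S + 1) → G) : ℝ :=
  -∑ e : Edge 4 (2 * S + 1),
    (if e.1 0 = 0 ∧ e.2 ≠ 0 then (r.ρ (gaugeTransform h U e)).trace.re else 0)

/-- The angle `π / (2S+1)`. -/
def thetaL (S : ℕ) : ℝ := π / (2 * S + 1 : ℝ)

/-- The diagonal entries `(e^{iπ/L}, e^{-iπ/L})` of the spread toron link. -/
def omegaVec (S : ℕ) : Fin 2 → ℂ :=
  ![Complex.exp ((thetaL S : ℂ) * Complex.I), Complex.exp (-((thetaL S : ℂ) * Complex.I))]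

/-- The diagonal entries are unimodular. -/
theorem omegaVec_mul_conj (S : ℕ) (i : Fin 2) : omegaVec S i * conj (omegaVec S i) = 1 := by
  have key : ∀ z : ℂ, z.re = 0 → Complex.exp z * conj (Complex.exp z) = 1 := by
    intro z hz
    rw [← Complex.exp_conj, ← Complex.exp_add, Complex.add_conj, hz]
    simp
  fin_cases i
  · exact key _ (by simp)
  · exact key _ (by simp)

/-- The spread toron link `ω = diag(e^{iπ/L}, e^{-iπ/L}) ∈ SU(2)`. -/
def omegaL (S : ℕ) : SU2 :=
  ⟨Matrix.diagonal (omegaVec S), by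
    rw [Matrix.mem_specialUnitaryGroup_iff, Matrix.mem_unitaryGroup_iff]
    refine ⟨?_, ?_⟩
    · rw [Matrix.star_eq_conjTranspose, Matrix.diagonal_conjTranspose, Matrix.diagonal_mul_diagonal,
        ← Matrix.diagonal_one]
      congr 1
      funext i
      simp [omegaVec_mul_conj]
    · rw [Matrix.det_diagonal, Fin.prod_univ_two]
      simp only [omegaVec, Matrix.cons_val_zero, Matrix.cons_val_one, Matrix.cons_val_fin_one]
      rw [← Complex.exp_add, add_neg_cancel, Complex.exp_zero]⟩

/-- The matrix of `ω`. -/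
@[simp] theorem omegaL_val (S : ℕ) : (omegaL S : Matrix (Fin 2) (Fin 2) ℂ) = Matrix.diagonal (omegaVec S) :=
  rfl

/-- `ω^L = −1`. -/
theorem omegaL_pow_val (S : ℕ) :
    ((omegaL S ^ (2 * S + 1) : SU2) : Matrix (Fin 2) (Fin 2) ℂ) = -1 := by
  rw [SubmonoidClass.coe_pow, omegaL_val, Matrix.diagonal_pow, ← Matrix.diagonal_one,
    Matrix.diagonal_neg]
  congr 1
  have hne : (2 * (S : ℂ) + 1) ≠ 0 := by exact_mod_cast (show (2 * S + 1 : ℕ) ≠ 0 by omega)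
  have hL : ((2 * S + 1 : ℕ) : ℂ) * ((thetaL S : ℝ) : ℂ) = π := by
    simp only [thetaL]; push_cast; field_simp [hne]
  funext i
  fin_cases i
  · show Complex.exp ((thetaL S : ℂ) * Complex.I) ^ (2 * S + 1) = -1
    rw [← Complex.exp_nat_mul, ← mul_assoc, hL, Complex.exp_pi_mul_I]
  · show Complex.exp (-((thetaL S : ℂ) * Complex.I)) ^ (2 * S + 1) = -1
    rw [← Complex.exp_nat_mul, mul_neg, ← mul_assoc, hL, Complex.exp_neg, Complex.exp_pi_mul_I]
    norm_num

/-- `Re tr ω = 2 cos(π/L)`. -/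
theorem re_trace_omegaL (S : ℕ) :
    ((omegaL S : Matrix (Fin 2) (Fin 2) ℂ)).trace.re = 2 * Real.cos (thetaL S) := by
  rw [omegaL_val, Matrix.trace_diagonal, Fin.sum_univ_two]
  simp only [omegaVec, Matrix.cons_val_zero, Matrix.cons_val_one, Matrix.cons_val_fin_one,
    Complex.add_re]
  rw [Complex.exp_ofReal_mul_I_re,
    show -((thetaL S : ℂ) * Complex.I) = ((-thetaL S : ℝ) : ℂ) * Complex.I by push_cast; ring,
    Complex.exp_ofReal_mul_I_re, Real.cos_neg]
  ring

/-- **The spread toron**: every direction-`1` link of the four-torus equals `ω`, all other links `1`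
(flat; holonomy `−1` around every `1`-cycle). -/
def toron (S : ℕ) : GaugeConfig 4 (2 * S + 1) SU2 := fun e => if e.2 = 1 then omegaL S else 1

/-- The trace of the fundamental representation, with the index type normalised to `Fin 2`. -/
theorem su2Fund_trace_re (g : SU2) :
    (su2Fund.ρ g).trace.re = ((g : Matrix (Fin 2) (Fin 2) ℂ)).trace.re := rfl

/-- For `V ∈ SU(2)`, `Re tr V = 2 Re V₀₀`. -/
theorem re_trace_su2 (V : SU2) :
    ((V : Matrix (Fin 2) (Fin 2) ℂ)).trace.re = 2 * ((V : Matrix (Fin 2) (Fin 2) ℂ) 0 0).re := by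
  rw [Matrix.trace_fin_two, su2_apply_11, Complex.add_re, Complex.conj_re]; ring

/-- For `V ∈ SU(2)`, `Re tr V ≤ 2`. -/
theorem re_trace_su2_le (V : SU2) : ((V : Matrix (Fin 2) (Fin 2) ℂ)).trace.re ≤ 2 := by
  rw [re_trace_su2]; linarith [re_le_one V]

/-- `Re tr 1 = 2` in `SU(2)`. -/
theorem re_trace_one_su2 : (((1 : SU2) : Matrix (Fin 2) (Fin 2) ℂ)).trace.re = 2 := by
  rw [OneMemClass.coe_one, Matrix.trace_one]; simp

/-- The gauge transformation by `1` is the identity. -/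
theorem gaugeTransform_one' {G : Type} [Group G] {d L : ℕ} (U : GaugeConfig d L G) :
    gaugeTransform 1 U = U := by
  funext e; simp [gaugeTransform]

/-- The spatial-slice edge sum as a site sum over the three spatial directions. -/
theorem sum_sliceEdges (F : Edge 4 (2 * S + 1) → ℝ) :
    ∑ e : Edge 4 (2 * S + 1), (if e.1 0 = 0 ∧ e.2 ≠ 0 then F e else 0) =
      ∑ x : Site 4 (2 * S + 1), (if x 0 = 0 then F (x, 1) + F (x, 2) + F (x, 3) else 0) := by
  rw [Fintype.sum_prod_type]
  refine Finset.sum_congr rfl fun x _ => ?_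
  rw [Fin.sum_univ_four]
  by_cases hx : x 0 = 0
  · simp [hx, show (1 : Fin 4) ≠ 0 by decide, show (2 : Fin 4) ≠ 0 by decide,
      show (3 : Fin 4) ≠ 0 by decide]
  · simp [hx]

/-- A sum over `ZMod (2S+1)` as a sum over `range (2S+1)` through the cast `ℕ → ZMod`. -/
theorem sum_zmod_eq_sum_range (f : ZMod (2 * S + 1) → ℝ) :
    ∑ n : ZMod (2 * S + 1), f n = ∑ i ∈ Finset.range (2 * S + 1), f (i : ℕ) := by
  calc ∑ n : ZMod (2 * S + 1), f n
      = ∑ n : ZMod (2 * S + 1), f ((n.val : ℕ) : ZMod (2 * S + 1)) := by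
        simp only [ZMod.natCast_zmod_val]
    _ = ∑ i ∈ Finset.range (2 * S + 1), f (i : ℕ) :=
        Fin.sum_univ_eq_sum_range (fun i => f (i : ℕ)) (2 * S + 1)

/-- Reindex a sum over the time-zero slice by (transverse coordinates, position along direction 1). -/
theorem sum_slice_lines (G : Site 4 (2 * S + 1) → ℝ) :
    ∑ x : Site 4 (2 * S + 1), (if x 0 = 0 then G x else 0) =
      ∑ z : Fin 2 → ZMod (2 * S + 1), ∑ i ∈ Finset.range (2 * S + 1),
        G (Fin.cons 0 (Fin.cons ((i : ℕ) : ZMod (2 * S + 1)) z)) := by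
  have h1 : ∑ x : Site 4 (2 * S + 1), (if x 0 = 0 then G x else 0) =
      ∑ p : ZMod (2 * S + 1) × (Fin 3 → ZMod (2 * S + 1)),
        (if p.1 = 0 then G (Fin.cons p.1 p.2) else 0) := by
    rw [← Equiv.sum_comp (Fin.consEquiv fun _ : Fin 4 => ZMod (2 * S + 1))]
    rfl
  have h2 : ∑ p : ZMod (2 * S + 1) × (Fin 3 → ZMod (2 * S + 1)),
        (if p.1 = 0 then G (Fin.cons p.1 p.2) else 0) =
      ∑ y : Fin 3 → ZMod (2 * S + 1), G (Fin.cons 0 y) := by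
    rw [Fintype.sum_prod_type]
    simp only [Finset.sum_ite_irrel, Finset.sum_const_zero, Finset.sum_ite_eq', Finset.mem_univ,
      if_true]
  have h3 : ∑ y : Fin 3 → ZMod (2 * S + 1), G (Fin.cons 0 y) =
      ∑ p : ZMod (2 * S + 1) × (Fin 2 → ZMod (2 * S + 1)), G (Fin.cons 0 (Fin.cons p.1 p.2)) := by
    rw [← Equiv.sum_comp (Fin.consEquiv fun _ : Fin 3 => ZMod (2 * S + 1))]
    rfl
  rw [h1, h2, h3, Fintype.sum_prod_type, Finset.sum_comm]
  exact Finset.sum_congr rfl fun z _ => sum_zmod_eq_sum_range (fun n => G (Fin.cons 0 (Fin.cons n z)))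

/-- The site on the line `z` at position `n` along direction `1`, time zero. -/
def lineSite (z : Fin 2 → ZMod (2 * S + 1)) (n : ZMod (2 * S + 1)) : Site 4 (2 * S + 1) :=
  Fin.cons 0 (Fin.cons n z)

/-- Shifting a line site in direction `1` moves one step along the line. -/
theorem lineSite_shift (z : Fin 2 → ZMod (2 * S + 1)) (n : ZMod (2 * S + 1)) :
    (lineSite z n).shift 1 = lineSite z (n + 1) := by
  rw [shift_one_eq_update]
  simp only [lineSite]
  rw [show (1 : Fin 4) = (0 : Fin 3).succ from rfl, Fin.cons_succ, ← Fin.cons_update, Fin.cons_zero,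
    Fin.update_cons_zero]

/-- Along direction 1 the gauge-transformed toron link at `lineSite z n` is `h(n) ω h(n+1)⁻¹`. -/
theorem gaugeTransform_toron_one (h : Site 4 (2 * S + 1) → SU2) (z : Fin 2 → ZMod (2 * S + 1))
    (n : ZMod (2 * S + 1)) :
    gaugeTransform h (toron S) (lineSite z n, 1) = h (lineSite z n) * omegaL S * (h (lineSite z (n + 1)))⁻¹ := by
  simp only [gaugeTransform, toron, if_true, lineSite_shift]

/-- The chain of transformed direction-1 links along the line `z`, indexed by `ℕ`. -/
def lineChain (h : Site 4 (2 * S + 1) → SU2) (z : Fin 2 → ZMod (2 * S + 1)) (i : ℕ) : SU2 :=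
  h (lineSite z (i : ZMod (2 * S + 1))) * omegaL S * (h (lineSite z ((i : ZMod (2 * S + 1)) + 1)))⁻¹

/-- Telescoping: `W₀ ⋯ W_{k-1} = h(0) ω^k h(k)⁻¹`. -/
theorem oprod_lineChain (h : Site 4 (2 * S + 1) → SU2) (z : Fin 2 → ZMod (2 * S + 1)) (k : ℕ) :
    oprod (lineChain h z) k = h (lineSite z 0) * omegaL S ^ k * (h (lineSite z (k : ZMod (2 * S + 1))))⁻¹ := by
  induction k with
  | zero => simp [oprod]
  | succ k ih =>
    rw [oprod, ih, lineChain, pow_succ]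
    push_cast
    group

/-- Around the torus the chain multiplies to `−1`. -/
theorem oprod_lineChain_full (h : Site 4 (2 * S + 1) → SU2) (z : Fin 2 → ZMod (2 * S + 1)) :
    ((oprod (lineChain h z) (2 * S + 1) : SU2) : Matrix (Fin 2) (Fin 2) ℂ) = -1 := by
  rw [oprod_lineChain, ZMod.natCast_self]
  rw [Submonoid.coe_mul, Submonoid.coe_mul, omegaL_pow_val]
  rw [Matrix.mul_neg, Matrix.mul_one, Matrix.neg_mul, ← Submonoid.coe_mul, mul_inv_cancel]
  rfl

/-- **Line bound**: along every line the transformed direction-1 links of the toron have total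
`Re tr` at most `L · 2cos(π/L)` — the value attained by `h = 1`. -/
theorem sum_line_le (hS : 2 ≤ S) (h : Site 4 (2 * S + 1) → SU2) (z : Fin 2 → ZMod (2 * S + 1)) :
    (∑ i ∈ Finset.range (2 * S + 1),
      (su2Fund.ρ (gaugeTransform h (toron S) (lineSite z ((i : ℕ) : ZMod (2 * S + 1)), 1))).trace.re)
      ≤ (2 * S + 1 : ℝ) * (2 * Real.cos (thetaL S)) := by
  have hL5 : 5 ≤ 2 * S + 1 := by omega
  have hchain : ∀ i : ℕ, gaugeTransform h (toron S) (lineSite z ((i : ℕ) : ZMod (2 * S + 1)), 1) =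
      lineChain h z i := fun i => by rw [gaugeTransform_toron_one]; rfl
  simp only [hchain, su2Fund_trace_re, re_trace_su2, ← cos_ang]
  rw [← Finset.mul_sum]
  have hang := sum_cos_le (2 * S + 1) hL5 (fun i => ang (lineChain h z i)) (fun i => ang_nonneg _)
    (fun i => ang_le_pi _) (pi_le_sum_ang _ _ (oprod_lineChain_full h z))
  have : ((2 * S + 1 : ℕ) : ℝ) = (2 * S + 1 : ℝ) := by push_cast; ring
  rw [this] at hang
  have hθ : thetaL S = π / (2 * (S : ℝ) + 1) := rfl
  rw [hθ]
  linarith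

/-- **The spread toron is an absolute minimiser of its slice Coulomb functional at `h = 1`**
(`S ≥ 2`): for every gauge transformation `h`, `coul(T, 1) ≤ coul(T, h)`. Directions 2, 3 are
term-wise optimal (`Re tr ≤ 2`); direction 1 is optimal line by line (`sum_line_le`: the ordered
product of the transformed links around a `1`-cycle is conjugate to `ω^L = −1`, so their rotation
angles sum to `≥ π`, and `Σ cos θ_i ≤ L cos(π/L)` by concavity). -/
theorem coul_toron_one_le (hS : 2 ≤ S) (h : Site 4 (2 * S + 1) → SU2) :
    coul su2Fund S (toron S) 1 ≤ coul su2Fund S (toron S) h := by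
  unfold coul
  rw [neg_le_neg_iff, sum_sliceEdges, sum_sliceEdges]
  -- split the three directions
  have hsplit : ∀ (P : Site 4 (2 * S + 1) → Prop) [DecidablePred P] (a b c : Site 4 (2 * S + 1) → ℝ),
      ∑ x, (if P x then a x + b x + c x else 0) =
        (∑ x, if P x then a x else 0) + (∑ x, if P x then b x else 0) + ∑ x, if P x then c x else 0 := by
    intro P _ a b c
    rw [← Finset.sum_add_distrib, ← Finset.sum_add_distrib]
    refine Finset.sum_congr rfl fun x _ => ?_
    split_ifs <;> simp
  rw [hsplit, hsplit]
  refine add_le_add (add_le_add ?_ ?_) ?_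
  · -- direction 1: line by line
    rw [sum_slice_lines, sum_slice_lines]
    refine Finset.sum_le_sum fun z _ => ?_
    refine (sum_line_le hS h z).trans (le_of_eq ?_)
    rw [Finset.sum_congr rfl fun i _ => by rw [gaugeTransform_one']]
    simp only [toron, if_true, su2Fund_trace_re, re_trace_omegaL, Finset.sum_const, Finset.card_range,
      nsmul_eq_mul]
    push_cast; ring
  · refine Finset.sum_le_sum fun x _ => ?_
    split_ifs
    · rw [gaugeTransform_one']
      simp only [toron, show (2 : Fin 4) ≠ 1 by decide, if_false, su2Fund_trace_re]
      exact (re_trace_su2_le _).trans (le_of_eq re_trace_one_su2.symm)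
    · exact le_rfl
  · refine Finset.sum_le_sum fun x _ => ?_
    split_ifs
    · rw [gaugeTransform_one']
      simp only [toron, show (3 : Fin 4) ≠ 1 by decide, if_false, su2Fund_trace_re]
      exact (re_trace_su2_le _).trans (le_of_eq re_trace_one_su2.symm)
    · exact le_rfl

end

end Summit.QuantumFields.YangMills.Theorems.CovarianceBound.Negative
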